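import Mathlib
import Summits.MatrixMultiplication.MatrixMultiplication.Theses.HiddenToeplitzCorners

/-!
# Honest Hankel pencils: a witness has an injective symbol map (negative side of crux `HiddenCorners`)

Line `ApolarSketch` of crux stmt-MatrixMultiplication-7492, stub `stub_honest` (= C⁺(δ = 2), honest Hankel
corners).  For a placement `W : ℕ → M_r(ℂ)` the honest Hankel pencil is `H_W(X) i j = tr (X * W (i + j))`
(`i, j < N`); it only reads the `2N - 1` symbols `k ↦ tr (X * W k)`, `k < 2N - 1`.

**Theorem (injectivity).** If `H_W` is generically nonsingular (`det H_W(X₀) ≠ 0` for some `X₀`) and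
singular on every singular `X`, then the symbol map `X ↦ (tr (X * W k))_{k < 2N-1}` is injective; hence
`r² ≤ 2N - 1`.  (Lines/apolar-kernel-placement.md §New (a); HonestHankelNoGo.md (R1).)  Proof: if
`tr (K * W k) = 0` for all `k < 2N - 1` then `F := det ∘ H_W` is invariant under `X ↦ X + tK`; the polynomials
`F` and `X ↦ tr (adj X * K)` are both nonzero (the latter at a transvection or a diagonal matrix), so some
`X₂` has `F X₂ ≠ 0` (hence `X₂` invertible) and `tr (adj X₂ * K) ≠ 0`; then `t ↦ det (X₂ + tK)` has the nonzero
linear coefficient `tr (adj X₂ * K)`, so it has a root `t₁`, and `F (X₂ + t₁ K) = F X₂ ≠ 0` contradicts the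
singularity hypothesis at the singular matrix `X₂ + t₁ K`.
-/

set_option linter.dupNamespace false

namespace Summit.MatrixMultiplication.MatrixMultiplication.Cruxes.HiddenCorners.ApolarSketch

open scoped BigOperators Matrix Polynomial
open Matrix

section Injective

variable {r : ℕ}

/-- Evaluating the symbolic Hankel determinant gives the Hankel determinant. -/
private theorem eval_det_hankPoly (N : ℕ) (W : ℕ → Matrix (Fin r) (Fin r) ℂ)
    (x : Fin r × Fin r → ℂ) :
    MvPolynomial.eval x
        (Matrix.of fun i j : Fin N =>
          ((mvPolynomialX (Fin r) (Fin r) ℂ) * (W ((i : ℕ) + (j : ℕ))).map MvPolynomial.C).trace).det =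
      (Matrix.of fun i j : Fin N =>
          ((Matrix.of fun a b : Fin r => x (a, b)) * W ((i : ℕ) + (j : ℕ))).trace).det := by
  rw [RingHom.map_det]
  congr 1
  ext i j
  simp [Matrix.trace, Matrix.mul_apply, mvPolynomialX]

/-- Evaluating the symbolic polynomial `X ↦ tr (adj X * K)` at `x` gives `tr (adj X * K)` for the matrix
`X` with entries `x`. -/
private theorem eval_adjTracePoly (K : Matrix (Fin r) (Fin r) ℂ) (x : Fin r × Fin r → ℂ) :
    MvPolynomial.eval x (((mvPolynomialX (Fin r) (Fin r) ℂ).adjugate * K.map MvPolynomial.C).trace) =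
      ((Matrix.of fun a b => x (a, b)).adjugate * K).trace := by
  have hX : (MvPolynomial.eval x).mapMatrix (mvPolynomialX (Fin r) (Fin r) ℂ) =
      Matrix.of fun a b => x (a, b) := by
    ext a b
    simp [mvPolynomialX]
  have hadj : (MvPolynomial.eval x).mapMatrix (mvPolynomialX (Fin r) (Fin r) ℂ).adjugate =
      (Matrix.of fun a b => x (a, b)).adjugate := by
    rw [RingHom.map_adjugate, hX]
  rw [Matrix.trace, Matrix.trace, map_sum]
  refine Finset.sum_congr rfl fun a _ => ?_
  rw [Matrix.diag_apply, Matrix.diag_apply, Matrix.mul_apply, Matrix.mul_apply, map_sum]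
  refine Finset.sum_congr rfl fun b _ => ?_
  rw [map_mul]
  have h1 : MvPolynomial.eval x ((mvPolynomialX (Fin r) (Fin r) ℂ).adjugate a b) =
      (Matrix.of fun a b => x (a, b)).adjugate a b := by
    have := congrArg (fun M => M a b) hadj
    simpa [RingHom.mapMatrix_apply, Matrix.map_apply] using this
  rw [h1]
  simp

/-- For `K ≠ 0` some matrix `Y` has `tr (adj Y * K) ≠ 0`: a transvection if `K` has a nonzero
off-diagonal entry, a diagonal matrix with one zero otherwise. -/
private theorem exists_trace_adjugate_mul_ne_zero (K : Matrix (Fin r) (Fin r) ℂ) (hK : K ≠ 0) :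
    ∃ Y : Matrix (Fin r) (Fin r) ℂ, (Y.adjugate * K).trace ≠ 0 := by
  by_cases hoff : ∃ a b : Fin r, a ≠ b ∧ K b a ≠ 0
  · obtain ⟨a, b, hab, hba⟩ := hoff
    -- try `Y = 1` first; if `tr K = 0`, use the transvection `1 + E_ab`
    by_cases htr : K.trace = 0
    · refine ⟨transvection a b 1, ?_⟩
      have hdet : (transvection a b (1 : ℂ)).det = 1 := det_transvection_of_ne a b hab 1
      have hinv : (transvection a b (1 : ℂ))⁻¹ = transvection a b (-1) := by
        apply inv_eq_right_inv
        rw [transvection_mul_transvection_same a b hab, add_neg_cancel, transvection_zero]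
      have hadj : (transvection a b (1 : ℂ)).adjugate = transvection a b (-1) := by
        rw [← hinv, inv_def, hdet]
        simp
      rw [hadj, transvection, Matrix.add_mul, Matrix.one_mul, trace_add, htr, zero_add,
        trace_single_mul]
      simpa using hba
    · exact ⟨1, by simpa using htr⟩
  · -- all off-diagonal entries vanish, so some diagonal entry is nonzero
    push Not at hoff
    have hdiag : ∃ a : Fin r, K a a ≠ 0 := by
      by_contra hcon
      push Not at hcon
      apply hK
      ext a b
      by_cases hab : a = b
      · subst hab; simpa using hcon a
      · exact hoff b a (Ne.symm hab)
    obtain ⟨a, ha⟩ := hdiag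
    refine ⟨diagonal fun i => if i = a then 0 else 1, ?_⟩
    rw [adjugate_diagonal]
    have hprod : (fun i : Fin r => ∏ j ∈ Finset.univ.erase i, (if j = a then (0 : ℂ) else 1)) =
        fun i => if i = a then 1 else 0 := by
      funext i
      by_cases hi : i = a
      · subst hi
        rw [if_pos rfl]
        refine Finset.prod_eq_one fun j hj => ?_
        rw [Finset.mem_erase] at hj
        simp [hj.1]
      · rw [if_neg hi]
        refine Finset.prod_eq_zero (i := a) ?_ (by simp)
        exact Finset.mem_erase.mpr ⟨Ne.symm hi, Finset.mem_univ _⟩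
    rw [hprod]
    have : (diagonal (fun i : Fin r => if i = a then (1 : ℂ) else 0) * K).trace = K a a := by
      simp [Matrix.trace, Matrix.diagonal_mul, Finset.sum_ite_eq']
    rw [this]
    exact ha

/-- The linear coefficient of `t ↦ det (A + tK)` at an invertible `A` is `tr (adj A * K)`, hence if it is
nonzero the polynomial has a root. -/
private theorem exists_det_add_smul_eq_zero (A K : Matrix (Fin r) (Fin r) ℂ) (hA : IsUnit A.det)
    (hP : (A.adjugate * K).trace ≠ 0) : ∃ t : ℂ, (A + t • K).det = 0 := by
  -- the polynomial `p t = det (A + t K)`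
  let p : ℂ[X] := (A.map Polynomial.C + (Polynomial.X : ℂ[X]) • K.map Polynomial.C).det
  have hp_eval : ∀ t : ℂ, p.eval t = (A + t • K).det := by
    intro t
    change (Polynomial.evalRingHom t) p = _
    rw [RingHom.map_det]
    congr 1
    ext i j
    simp [Matrix.map_apply, Matrix.add_apply, Matrix.smul_apply]
    ring
  -- factor `A` out: `A + X K = A (1 + X (A⁻¹ K))`
  have hfac : A.map Polynomial.C + (Polynomial.X : ℂ[X]) • K.map Polynomial.C =
      A.map Polynomial.C * (1 + (Polynomial.X : ℂ[X]) • (A⁻¹ * K).map Polynomial.C) := by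
    rw [Matrix.mul_add, Matrix.mul_one, Matrix.mul_smul, ← Matrix.map_mul, ← Matrix.mul_assoc,
      Matrix.mul_nonsing_inv A hA, Matrix.one_mul]
  have hcoeff : p.coeff 1 = A.det * (A⁻¹ * K).trace := by
    change (A.map Polynomial.C + (Polynomial.X : ℂ[X]) • K.map Polynomial.C).det.coeff 1 = _
    rw [hfac, Matrix.det_mul]
    have hdetC : (A.map (Polynomial.C : ℂ → ℂ[X])).det = Polynomial.C A.det := by
      have := (RingHom.map_det (Polynomial.C : ℂ →+* ℂ[X]) A).symm
      simpa [RingHom.mapMatrix_apply] using this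
    rw [hdetC, Polynomial.coeff_C_mul, coeff_det_one_add_X_smul_one]
  -- `tr (adj A * K) = det A * tr (A⁻¹ K)`
  have hadj : (A.adjugate * K).trace = A.det * (A⁻¹ * K).trace := by
    have hsm : A.adjugate = A.det • A⁻¹ := by
      rw [inv_def, smul_smul, Ring.mul_inverse_cancel _ hA, one_smul]
    rw [hsm, Matrix.smul_mul, trace_smul, smul_eq_mul]
  have hc1 : p.coeff 1 ≠ 0 := by rw [hcoeff, ← hadj]; exact hP
  have hdeg : 0 < p.degree := by
    by_contra hle
    push Not at hle
    have := Polynomial.eq_C_of_degree_le_zero hle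
    apply hc1
    rw [this, Polynomial.coeff_C]
    simp
  obtain ⟨t, ht⟩ := Complex.exists_root hdeg
  exact ⟨t, by rw [← hp_eval]; exact ht⟩

/-- **Injectivity of the symbol map of an honest witness.**  If the honest Hankel pencil of `W` is
generically nonsingular and singular on every singular matrix, then no nonzero `K` has all symbols
`tr (K * W k)`, `k < 2N - 1`, equal to zero. -/
theorem honest_symbol_eq_zero (r N : ℕ) (W : ℕ → Matrix (Fin r) (Fin r) ℂ)
    (h1 : ∃ X₀ : Matrix (Fin r) (Fin r) ℂ,
      (Matrix.of fun i j : Fin N => (X₀ * W ((i : ℕ) + (j : ℕ))).trace).det ≠ 0)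
    (h2 : ∀ X : Matrix (Fin r) (Fin r) ℂ, X.det = 0 →
      (Matrix.of fun i j : Fin N => (X * W ((i : ℕ) + (j : ℕ))).trace).det = 0)
    (K : Matrix (Fin r) (Fin r) ℂ) (hK : ∀ k, k < 2 * N - 1 → (K * W k).trace = 0) : K = 0 := by
  by_contra hK0
  -- invariance of the Hankel pencil under `X ↦ X + tK`
  have hinv : ∀ (X : Matrix (Fin r) (Fin r) ℂ) (t : ℂ),
      (Matrix.of fun i j : Fin N => ((X + t • K) * W ((i : ℕ) + (j : ℕ))).trace) =
        Matrix.of fun i j : Fin N => (X * W ((i : ℕ) + (j : ℕ))).trace := by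
    intro X t
    ext i j
    have hij : (i : ℕ) + (j : ℕ) < 2 * N - 1 := by omega
    simp [Matrix.add_mul, trace_add, trace_smul, hK _ hij]
  -- the two nonzero polynomials
  obtain ⟨X₀, hX₀⟩ := h1
  have hF : (Matrix.of fun i j : Fin N =>
      ((mvPolynomialX (Fin r) (Fin r) ℂ) * (W ((i : ℕ) + (j : ℕ))).map MvPolynomial.C).trace).det ≠ 0 := by
    intro h0
    apply hX₀
    have := eval_det_hankPoly N W (fun p => X₀ p.1 p.2)
    rw [h0, map_zero] at this
    have hofX : (Matrix.of fun a b => X₀ a b) = X₀ := by ext a b; rfl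
    rw [hofX] at this
    exact this.symm
  obtain ⟨Y, hY⟩ := exists_trace_adjugate_mul_ne_zero K hK0
  have hPne : ((mvPolynomialX (Fin r) (Fin r) ℂ).adjugate * K.map MvPolynomial.C).trace ≠ 0 := by
    intro h0
    apply hY
    have := eval_adjTracePoly K (fun p => Y p.1 p.2)
    rw [h0, map_zero] at this
    have hofY : (Matrix.of fun a b => Y a b) = Y := by ext a b; rfl
    rw [hofY] at this
    exact this.symm
  -- a common non-root
  have hprod := mul_ne_zero hF hPne
  obtain ⟨x, hx⟩ : ∃ x : Fin r × Fin r → ℂ,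
      MvPolynomial.eval x ((Matrix.of fun i j : Fin N =>
        ((mvPolynomialX (Fin r) (Fin r) ℂ) * (W ((i : ℕ) + (j : ℕ))).map MvPolynomial.C).trace).det *
        ((mvPolynomialX (Fin r) (Fin r) ℂ).adjugate * K.map MvPolynomial.C).trace) ≠ 0 := by
    by_contra hall
    push Not at hall
    exact hprod (MvPolynomial.funext fun x => by rw [hall x, map_zero])
  rw [map_mul] at hx
  set X₂ : Matrix (Fin r) (Fin r) ℂ := Matrix.of fun a b => x (a, b) with hX₂
  have hF2 : (Matrix.of fun i j : Fin N => (X₂ * W ((i : ℕ) + (j : ℕ))).trace).det ≠ 0 := by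
    rw [hX₂, ← eval_det_hankPoly]; exact left_ne_zero_of_mul hx
  have hP2 : (X₂.adjugate * K).trace ≠ 0 := by
    rw [hX₂, ← eval_adjTracePoly]; exact right_ne_zero_of_mul hx
  -- `X₂` is invertible
  have hdet2 : X₂.det ≠ 0 := fun h0 => hF2 (h2 X₂ h0)
  obtain ⟨t, ht⟩ := exists_det_add_smul_eq_zero X₂ K (isUnit_iff_ne_zero.mpr hdet2) hP2
  -- contradiction at the singular matrix `X₂ + tK`
  have := h2 (X₂ + t • K) ht
  rw [hinv] at this
  exact hF2 this

/-- **Size bound.** An honest witness has `r ^ 2 ≤ 2 * N - 1` (the symbol map `M_r(ℂ) → ℂ^{2N-1}` is an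
injective linear map). -/
theorem honest_sq_le (r N : ℕ) (W : ℕ → Matrix (Fin r) (Fin r) ℂ)
    (h1 : ∃ X₀ : Matrix (Fin r) (Fin r) ℂ,
      (Matrix.of fun i j : Fin N => (X₀ * W ((i : ℕ) + (j : ℕ))).trace).det ≠ 0)
    (h2 : ∀ X : Matrix (Fin r) (Fin r) ℂ, X.det = 0 →
      (Matrix.of fun i j : Fin N => (X * W ((i : ℕ) + (j : ℕ))).trace).det = 0) :
    r ^ 2 ≤ 2 * N - 1 := by
  -- the symbol map
  let Φ : Matrix (Fin r) (Fin r) ℂ →ₗ[ℂ] (Fin (2 * N - 1) → ℂ) :=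
    { toFun := fun X k => (X * W (k : ℕ)).trace
      map_add' := fun X Y => by funext k; simp [Matrix.add_mul, trace_add]
      map_smul' := fun c X => by funext k; simp [trace_smul] }
  have hinj : Function.Injective Φ := by
    rw [injective_iff_map_eq_zero]
    intro K hKΦ
    refine honest_symbol_eq_zero r N W h1 h2 K fun k hk => ?_
    have := congrFun hKΦ ⟨k, hk⟩
    simpa [Φ] using this
  have h := LinearMap.finrank_le_finrank_of_injective hinj
  simpa [Module.finrank_matrix, Module.finrank_fin_fun, pow_two] using h

end Injective

end Summit.MatrixMultiplication.MatrixMultiplication.Cruxes.HiddenCorners.ApolarSketch
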